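import Summits.NavierStokesRegularity.NavierStokesRegularity.Theses.RellichScar
import Summits.NavierStokesRegularity.NavierStokesRegularity.Theorems.SymmetricScarExists.Negative.SpiralWorld
import Literature.Analysis.FluidPDE.LocalTypeI
import Literature.Analysis.FluidPDE.LocalTypeICongr
import Literature.Analysis.FluidPDE.SlabTypeICompactness

/-!
# Stub `stub_slabLimit` for line analytic-scar-window-rigidity of crux `SymmetricScarExists`
# (stmt-NavierStokesRegularity-11718): compactness of singular apex Type-I profiles on the slab

A sequence `(v_k, q_k, H_k)` of SINGULAR APEX PROFILES — suitable weak solutions of Navier–Stokes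
(`ν = 1`, `f = 0`) on the backward slab `(-∞, 0) × ℝ³` with weak spatial gradients,
Albritton–Barker quantity `𝐈(ℝ³ × ℝ₋) ≤ I < ∞`, the pointwise apex bound
`‖v_k(t, x)‖ ≤ C / (‖x‖ + √(−t))` (`t < 0`) with ONE constant `C ≥ 0`, and a backward-singular
space–time origin — subconverges in `L³(Q(0, R))` for every `R > 0` to a singular apex profile with
the SAME constant `C` (and `𝐈 < ∞`).

Proof (all engines are in the Literature tree):

1. `Literature.Analysis.FluidPDE.slab_typeI_compactness` (Albritton–Barker 2019, Lemma 2.2 +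
   Prop. 2.3 + §3, exhausted to the slab) extracts a subsequence `φ` and an a.e.-limit
   `(u₀, p, G)` — suitable weak on the slab, weak gradient `G`, `𝐈 ≤ 4 I < ∞` — with
   `v_{φ j} → u₀` in `L³(Q(0, R))` for every `R > 0`; every `v_k` being singular at the origin,
   `‖v_{φ j}‖_{L^∞(Q(0,R))} = ∞` for all `j`, so the origin is a backward singular point of `u₀`
   (A–B Prop. 2.3, persistence of singularities).
2. `L³(Q(0, n+1))`-convergence is convergence in measure, hence a.e.-convergence along a further
   subsequence on `Q(0, n+1)` (`tendstoInMeasure_of_tendsto_eLpNorm`,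
   `TendstoInMeasure.exists_seq_tendsto_ae`); the closed pointwise bound
   `‖·‖ ≤ C / (‖x‖ + √(−t))` passes to the a.e.-limit, and the balls `Q(0, n+1)`, `n : ℕ`,
   exhaust the slab, so `u₀` obeys the apex bound a.e. on `(-∞, 0) × ℝ³`.
3. `Literature.Analysis.FluidPDE.exists_apex_profile_repr` replaces `u₀` by an a.e.-equal
   representative `u` obeying the apex bound EVERYWHERE (same `p`, `G`: suitability, the weak
   gradient, `𝐈 < ∞` and the singular origin are a.e.-invariant), and the `L³(Q(0, R))`
   convergence is unchanged (`eLpNorm_congr_ae`, `Q(0, R) ⊆ (-∞, 0) × ℝ³`).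

## References

* D. Albritton, T. Barker, *On local Type I singularities of the Navier–Stokes equations and
  Liouville theorems*, J. Math. Fluid Mech. 21 (2019), no. 43 = arXiv:1811.00502, Lemma 2.2,
  Prop. 2.3, §3. [AlbrittonBarker2019]
* G. Koch, N. Nadirashvili, G. Seregin, V. Šverák, Acta Math. 203 (2009), (1.6). [KNSS2009]
-/

noncomputable section

open MeasureTheory Set Function Filter Topology TopologicalSpace Metric
open scoped NNReal ENNReal

namespace Summit.NavierStokesRegularity.NavierStokesRegularity.Theorems.SymmetricScarExists.ScarWindow

open Literature.Analysis.FluidPDE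
open Summit.NavierStokesRegularity.NavierStokesRegularity.Theses.RellichScar
open Summit.NavierStokesRegularity.NavierStokesRegularity.Theorems.SymmetricScarExists.Negative

set_option linter.dupNamespace false

/-- The parabolic balls `Q(0, n+1) = (-(n+1)², 0) × B(0, n+1)`, `n : ℕ`, exhaust the backward
slab `(-∞, 0) × ℝ³`. -/
theorem lowerHalf_subset_iUnion_parabolicCylinder :
    Iio (0 : ℝ) ×ˢ (univ : Set (EuclideanSpace ℝ (Fin 3))) ⊆
      ⋃ n : ℕ, parabolicCylinder ((n : ℝ) + 1) (0 : ℝ × EuclideanSpace ℝ (Fin 3)) := by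
  rintro w ⟨hw, -⟩
  obtain ⟨n, hn⟩ := exists_nat_ge (max (-w.1) ‖w.2‖)
  refine mem_iUnion.2 ⟨n, ?_⟩
  rw [SuitableCompactness.mem_parabolicCylinder_zero]
  have h1 : -w.1 ≤ n := (le_max_left _ _).trans hn
  have h2 : ‖w.2‖ ≤ n := (le_max_right _ _).trans hn
  have h3 : (n : ℝ) < ((n : ℝ) + 1) ^ 2 := by nlinarith [n.cast_nonneg (α := ℝ)]
  exact ⟨⟨by linarith, hw⟩, by linarith⟩

/-- **A closed pointwise bound passes to `L³`-limits almost everywhere.**  If `V_j → u` in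
`L³(Q(0, R))` and every `V_j` obeys the apex bound `‖V_j(t, x)‖ ≤ C / (‖x‖ + √(−t))` for
`t < 0`, then `u` obeys it a.e. on `Q(0, R)`: a subsequence converges a.e. (convergence in
measure), and `‖·‖ ≤ c` is closed. -/
theorem ae_apexBound_of_tendsto_eLpNorm {C R : ℝ}
    {V : ℕ → ℝ → EuclideanSpace ℝ (Fin 3) → EuclideanSpace ℝ (Fin 3)}
    {u : ℝ → EuclideanSpace ℝ (Fin 3) → EuclideanSpace ℝ (Fin 3)}
    (hVm : ∀ j, AEStronglyMeasurable (uncurry (V j))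
      (volume.restrict (parabolicCylinder R (0 : ℝ × EuclideanSpace ℝ (Fin 3)))))
    (hum : AEStronglyMeasurable (uncurry u)
      (volume.restrict (parabolicCylinder R (0 : ℝ × EuclideanSpace ℝ (Fin 3)))))
    (hconv : Tendsto (fun j => eLpNorm (uncurry (V j) - uncurry u) 3
      (volume.restrict (parabolicCylinder R (0 : ℝ × EuclideanSpace ℝ (Fin 3))))) atTop (𝓝 0))
    (hdec : ∀ j, HasTypeIDecay C (V j)) :
    ∀ᵐ w ∂(volume.restrict (parabolicCylinder R (0 : ℝ × EuclideanSpace ℝ (Fin 3)))),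
      ‖u w.1 w.2‖ ≤ C / (‖w.2‖ + Real.sqrt (-w.1)) := by
  have hTIM := tendstoInMeasure_of_tendsto_eLpNorm (by norm_num) hVm hum hconv
  obtain ⟨ns, -, hae⟩ := hTIM.exists_seq_tendsto_ae
  filter_upwards [hae, ae_restrict_mem (isOpen_parabolicCylinder R _).measurableSet] with w hw hwQ
  have ht : w.1 < 0 := by
    rw [SuitableCompactness.mem_parabolicCylinder_zero] at hwQ
    exact hwQ.1.2
  exact le_of_tendsto hw.norm (Eventually.of_forall fun i => hdec (ns i) w.1 ht w.2)

/-- **Compactness of singular apex Type-I profiles on the slab** (Albritton–Barker 2019,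
Lemma 2.2 + Prop. 2.3 exhausted to the slab, plus the choice of a representative with the
POINTWISE apex bound).  A sequence of suitable weak solutions on `(-∞, 0) × ℝ³` with weak
gradients, `𝐈 ≤ I < ∞`, the apex bound `‖v_k(t,x)‖ ≤ C/(‖x‖ + √(−t))` with one constant `C ≥ 0`
and a backward-singular origin subconverges in `L³(Q(0, R))`, every `R > 0`, to a suitable weak
solution on the slab with a weak gradient, `𝐈 < ∞`, the same pointwise apex bound and a
backward-singular origin. -/
theorem stub_slabLimit :
    ∀ (C : ℝ) (I : ℝ≥0∞) (v : ℕ → ℝ → EuclideanSpace ℝ (Fin 3) → EuclideanSpace ℝ (Fin 3)) (q : ℕ → ℝ → EuclideanSpace ℝ (Fin 3) → ℝ) (H : ℕ → ℝ → EuclideanSpace ℝ (Fin 3) → EuclideanSpace ℝ (Fin 3) →L[ℝ] EuclideanSpace ℝ (Fin 3)),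
      0 ≤ C → I < ⊤ →
      (∀ k : ℕ, IsSuitableWeakSolutionOn (slab (EuclideanSpace ℝ (Fin 3)) (Iio (0 : ℝ)) isOpen_Iio) 1 0 (v k) (q k) ∧ HasWeakSpatialGradientOn (slab (EuclideanSpace ℝ (Fin 3)) (Iio (0 : ℝ)) isOpen_Iio) (v k) (H k) ∧ typeIBound (Iio (0 : ℝ) ×ˢ univ) (v k) (q k) (H k) ≤ I ∧ HasTypeIDecay C (v k) ∧ IsBackwardSingularPoint (v k) 0) →
      ∃ (u : ℝ → EuclideanSpace ℝ (Fin 3) → EuclideanSpace ℝ (Fin 3)) (p : ℝ → EuclideanSpace ℝ (Fin 3) → ℝ) (G : ℝ → EuclideanSpace ℝ (Fin 3) → EuclideanSpace ℝ (Fin 3) →L[ℝ] EuclideanSpace ℝ (Fin 3)) (φ : ℕ → ℕ),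
        StrictMono φ ∧
        IsSuitableWeakSolutionOn (slab (EuclideanSpace ℝ (Fin 3)) (Iio (0 : ℝ)) isOpen_Iio) 1 0 u p ∧ HasWeakSpatialGradientOn (slab (EuclideanSpace ℝ (Fin 3)) (Iio (0 : ℝ)) isOpen_Iio) u G ∧ typeIBound (Iio (0 : ℝ) ×ˢ univ) u p G < ⊤ ∧ HasTypeIDecay C u ∧ IsBackwardSingularPoint u 0 ∧
        (∀ R : ℝ, 0 < R → Tendsto (fun j => eLpNorm (uncurry (v (φ j)) - uncurry u) 3 (volume.restrict (parabolicCylinder R (0 : ℝ × EuclideanSpace ℝ (Fin 3))))) atTop (𝓝 0)) := by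
  intro C I v q H hC hI h
  -- ## Step 1: Albritton–Barker compactness on the slab along a subsequence `φ`
  obtain ⟨u₀, p, G, φ, hφ, hsw₀, hwg₀, h4I, hconv, hpers⟩ :=
    slab_typeI_compactness I v q H hI (fun k => (h k).1) (fun k => (h k).2.1)
      (fun k => (h k).2.2.1)
  -- ## Step 2: the origin stays singular (every approximant is unbounded on every `Q(0, R)`)
  have hsing₀ : IsBackwardSingularPoint u₀ 0 := by
    refine hpers fun R hR => ?_
    have e : (fun j => eLpNorm (uncurry (v (φ j))) ⊤
        (volume.restrict (parabolicCylinder R (0 : ℝ × EuclideanSpace ℝ (Fin 3))))) =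
        fun _ => ⊤ :=
      funext fun j => (h (φ j)).2.2.2.2 R hR
    rw [e]
    exact limsup_const ⊤
  -- ## Step 3: `𝐈 < ∞`
  have hIfin : typeIBound (Iio (0 : ℝ) ×ˢ univ) u₀ p G < ⊤ :=
    lt_of_le_of_lt h4I (ENNReal.mul_lt_top (by simp) hI)
  -- ## Step 4: the apex bound almost everywhere on the slab
  have hapex : ∀ᵐ w ∂(volume.restrict (Iio (0 : ℝ) ×ˢ (univ : Set (EuclideanSpace ℝ (Fin 3))))),
      ‖u₀ w.1 w.2‖ ≤ C / (‖w.2‖ + Real.sqrt (-w.1)) := by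
    refine ae_restrict_of_ae_restrict_of_subset lowerHalf_subset_iUnion_parabolicCylinder ?_
    rw [ae_restrict_iUnion_iff]
    intro n
    have hQs : parabolicCylinder ((n : ℝ) + 1) (0 : ℝ × EuclideanSpace ℝ (Fin 3)) ⊆
        Iio (0 : ℝ) ×ˢ (univ : Set (EuclideanSpace ℝ (Fin 3))) :=
      parabolicCylinder_subset_lowerHalf le_rfl _
    have hVm : ∀ j, AEStronglyMeasurable (uncurry (v (φ j)))
        (volume.restrict (parabolicCylinder ((n : ℝ) + 1) (0 : ℝ × EuclideanSpace ℝ (Fin 3)))) :=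
      fun j => (h (φ j)).2.1.locallyIntegrableOn.aestronglyMeasurable.mono_measure
        (Measure.restrict_mono hQs le_rfl)
    have hum : AEStronglyMeasurable (uncurry u₀)
        (volume.restrict (parabolicCylinder ((n : ℝ) + 1) (0 : ℝ × EuclideanSpace ℝ (Fin 3)))) :=
      hwg₀.locallyIntegrableOn.aestronglyMeasurable.mono_measure (Measure.restrict_mono hQs le_rfl)
    exact ae_apexBound_of_tendsto_eLpNorm hVm hum (hconv _ (by positivity))
      fun j => (h (φ j)).2.2.2.1
  -- ## Step 5: a representative with the pointwise apex bound (same `p`, `G`)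
  obtain ⟨u, hae, hsw, hwg, hIu, hdec, hsing⟩ :=
    exists_apex_profile_repr hC hsw₀ hwg₀ hIfin hsing₀ hapex
  refine ⟨u, p, G, φ, hφ, hsw, hwg, hIu, hdec, hsing, fun R hR => ?_⟩
  have haeR : ∀ᵐ w ∂(volume.restrict (parabolicCylinder R (0 : ℝ × EuclideanSpace ℝ (Fin 3)))),
      uncurry u₀ w = uncurry u w :=
    ae_restrict_of_ae_restrict_of_subset (parabolicCylinder_subset_lowerHalf le_rfl R) hae
  refine (hconv R hR).congr fun j => eLpNorm_congr_ae ?_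
  filter_upwards [haeR] with w hw
  simp only [Pi.sub_apply, hw]

end Summit.NavierStokesRegularity.NavierStokesRegularity.Theorems.SymmetricScarExists.ScarWindow

end
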